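import Mathlib
import Literature.MathematicalPhysics.QuantumLattice.BondPairModes
import HarnessLib

/-!
# Bond-pair modes on the torus: splitting off the zero-momentum block

Companion of `Literature.MathematicalPhysics.QuantumLattice.BondPairModes` (same notation: the
nearest-neighbour singlet bonds `B_x(e_i) = singletBond L x (Pi.single i 1)` on `(ℤ/Lℤ)²`, the bond-pair
mode operator `B(φ) = Σ_x Σ_i φ x i • B_x(e_i)` of a mode `φ : (ℤ/Lℤ)² → Fin 2 → ℂ`, written out verbatim,
and the zero-momentum bond pair fields `P_h`, `P_v = pairField ((extendedSWave ± dWaveFormFactor)/2) L`).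
Mode space splits orthogonally into the two uniform (zero-momentum) modes `V₀ = {fun _ j => w j • L⁻¹}` and
their complement `V₀^⊥ = {χ | Σ_x χ x 0 = Σ_x χ x 1 = 0}`; for the PSD Gram matrix `M_ψ` of the bonds this
file proves the operator-norm splitting `λ_max(M_ψ) ≤ tr(M_ψ|V₀) + λ_max(M_ψ|V₀^⊥)` in elementary form:

* `bondModeOp_add/smul`, `bondMode_norm_sq_smul`, `mode_norm_sq_smul`, `mode_eq_zero_of_norm_sq_eq_zero`:
  (sesqui)linearity bookkeeping of `φ ↦ B(φ)`;
* `zeroMomentumMode_norm_sq_le_mul`: the HOMOGENEOUS zero-momentum bound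
  `‖B(fun _ j => w j L⁻¹)ψ‖² ≤ (Σ_j ‖w j‖²) · (‖P_hψ‖² + ‖P_vψ‖²)/(2L²)` (no normalisation hypothesis);
* `bondMode_norm_sq_le_split`: if every `χ ∈ V₀^⊥` has `‖B(χ)ψ‖² ≤ D · Σ‖χ‖²` then EVERY mode has
  `‖B(φ)ψ‖² ≤ ((‖P_hψ‖² + ‖P_vψ‖²)/(2L²) + D) · Σ‖φ‖²` (`φ = φ₀ + φ⊥`, Pythagoras, triangle inequality,
  Cauchy–Schwarz; no translation covariance of `ψ` is used);
* `bondMode_perp_bound_homog` (normalised ⇒ homogeneous) and the fixed-side reduction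
  `bondMode_norm_sq_le_of_perp`: if every normalised `φ ∈ V₀^⊥` has `‖B(φ)ψ‖² ≤ E` then every normalised
  `φ` has `‖B(φ)ψ‖² ≤ (‖P_hψ‖² + ‖P_vψ‖²)/(2L²) + E` — "uniform-mode dominance" is EQUIVALENT, up to the
  zero-momentum trace, to "no bond-pair mode orthogonal to the uniform ones is occupied beyond `E`".

Any side `L ≥ 1`, any Fock vector `ψ`; pure linear algebra. Sources for the objects and the eigenvalue
language: C. N. Yang, Rev. Mod. Phys. 34 (1962) 694, §4; D. J. Scalapino, Phys. Rep. 250 (1995) 329, §2;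
D. F. Agterberg et al., Annu. Rev. Condens. Matter Phys. 11 (2020) 231 (pair-density waves = non-uniform
pair condensates). All proofs are folklore. (Written by the lead seat of crux stmt-HubbardSuperconductivity-0934
from its stub-worker's reduction of `stub_uniformModeDominance`.)
-/

noncomputable section

namespace Literature.MathematicalPhysics.QuantumLattice.BondMode

open Matrix Finset Filter
open scoped ComplexOrder ComplexConjugate
open Literature.Probability.LatticeModels

/-! ### Linearity bookkeeping for the bond-pair mode operator `B(φ) = Σ_x Σ_i φ x i • B_x(e_i)` -/

section Linearity

variable (L : ℕ) [NeZero L]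

/-- `B(φ + χ) = B(φ) + B(χ)`. [folklore] -/
theorem bondModeOp_add (φ χ : TorusSite 2 L → Fin 2 → ℂ) :
    (∑ x : TorusSite 2 L, ∑ i : Fin 2, (φ x i + χ x i) • singletBond L x (Pi.single i 1)) =
      (∑ x : TorusSite 2 L, ∑ i : Fin 2, φ x i • singletBond L x (Pi.single i 1)) +
        ∑ x : TorusSite 2 L, ∑ i : Fin 2, χ x i • singletBond L x (Pi.single i 1) := by
  simp only [add_smul, Finset.sum_add_distrib]

/-- `B(c • φ) = c • B(φ)`. [folklore] -/
theorem bondModeOp_smul (c : ℂ) (φ : TorusSite 2 L → Fin 2 → ℂ) :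
    (∑ x : TorusSite 2 L, ∑ i : Fin 2, (c * φ x i) • singletBond L x (Pi.single i 1)) =
      c • ∑ x : TorusSite 2 L, ∑ i : Fin 2, φ x i • singletBond L x (Pi.single i 1) := by
  simp only [mul_smul, Finset.smul_sum]

/-- `‖B(c • φ)ψ‖² = ‖c‖² ‖B(φ)ψ‖²` (real parts). [folklore] -/
theorem bondMode_norm_sq_smul (c : ℂ) (φ : TorusSite 2 L → Fin 2 → ℂ)
    (ψ : Fock (Orb (FermionTorus 2 L))) :
    (star ((∑ x : TorusSite 2 L, ∑ i : Fin 2, (c * φ x i) • singletBond L x (Pi.single i 1)) *ᵥ ψ) ⬝ᵥ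
      ((∑ x : TorusSite 2 L, ∑ i : Fin 2, (c * φ x i) • singletBond L x (Pi.single i 1)) *ᵥ ψ)).re =
      ‖c‖ ^ 2 * (star ((∑ x : TorusSite 2 L, ∑ i : Fin 2, φ x i • singletBond L x (Pi.single i 1)) *ᵥ ψ) ⬝ᵥ
        ((∑ x : TorusSite 2 L, ∑ i : Fin 2, φ x i • singletBond L x (Pi.single i 1)) *ᵥ ψ)).re := by
  rw [bondModeOp_smul, BondMode.star_smul_mulVec_dotProduct, Complex.re_ofReal_mul]

/-- `Σ ‖c φ x i‖² = ‖c‖² Σ ‖φ x i‖²` (the site sum needs `L ≠ 0`: `ZMod 0 = ℤ` is infinite). [folklore] -/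
theorem mode_norm_sq_smul (c : ℂ) (φ : TorusSite 2 L → Fin 2 → ℂ) :
    ∑ x : TorusSite 2 L, ∑ i : Fin 2, ‖c * φ x i‖ ^ 2 =
      ‖c‖ ^ 2 * ∑ x : TorusSite 2 L, ∑ i : Fin 2, ‖φ x i‖ ^ 2 := by
  simp only [norm_mul, mul_pow, Finset.mul_sum]

/-- A mode with `Σ ‖φ x i‖² = 0` vanishes identically. [folklore] -/
theorem mode_eq_zero_of_norm_sq_eq_zero (φ : TorusSite 2 L → Fin 2 → ℂ)
    (h : ∑ x : TorusSite 2 L, ∑ i : Fin 2, ‖φ x i‖ ^ 2 = 0) (x : TorusSite 2 L) (i : Fin 2) :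
    φ x i = 0 := by
  have hx := (Finset.sum_eq_zero_iff_of_nonneg fun y _ =>
    Finset.sum_nonneg fun j _ => sq_nonneg (‖φ y j‖)).1 h x (Finset.mem_univ x)
  have hxi := (Finset.sum_eq_zero_iff_of_nonneg fun j _ => sq_nonneg (‖φ x j‖)).1 hx i (Finset.mem_univ i)
  exact norm_eq_zero.1 (pow_eq_zero_iff two_ne_zero |>.1 hxi)

end Linearity

/-! ### Two real-arithmetic facts -/

/-- `(n₀ + n₁)² ≤ (A + D)(W + F)` whenever `n₀² ≤ A W`, `n₁² ≤ D F` (all quantities nonnegative):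
the Cauchy–Schwarz step of the operator-norm splitting. [folklore] -/
theorem sq_add_le_mul_add {n₀ n₁ A D W F : ℝ} (hn₀ : 0 ≤ n₀) (hn₁ : 0 ≤ n₁) (hA : 0 ≤ A)
    (hD : 0 ≤ D) (hW : 0 ≤ W) (hF : 0 ≤ F) (h₀ : n₀ ^ 2 ≤ A * W) (h₁ : n₁ ^ 2 ≤ D * F) :
    (n₀ + n₁) ^ 2 ≤ (A + D) * (W + F) := by
  have e₀ : n₀ ≤ Real.sqrt A * Real.sqrt W := by
    rw [← Real.sqrt_mul hA]; exact Real.le_sqrt_of_sq_le h₀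
  have e₁ : n₁ ≤ Real.sqrt D * Real.sqrt F := by
    rw [← Real.sqrt_mul hD]; exact Real.le_sqrt_of_sq_le h₁
  calc (n₀ + n₁) ^ 2 ≤ (Real.sqrt A * Real.sqrt W + Real.sqrt D * Real.sqrt F) ^ 2 :=
        pow_le_pow_left₀ (add_nonneg hn₀ hn₁) (add_le_add e₀ e₁) 2
    _ ≤ (Real.sqrt A ^ 2 + Real.sqrt D ^ 2) * (Real.sqrt W ^ 2 + Real.sqrt F ^ 2) :=
        BondMode.sq_add_mul_le _ _ _ _
    _ = (A + D) * (W + F) := by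
        rw [Real.sq_sqrt hA, Real.sq_sqrt hD, Real.sq_sqrt hW, Real.sq_sqrt hF]

/-! ### The homogeneous zero-momentum bound -/

section ZeroMomentum

variable (L : ℕ) [NeZero L]

/-- **Homogeneous zero-momentum bound.** For every `w : Fin 2 → ℂ` (no normalisation) and every Fock
vector `ψ`, the zero-momentum mode `φ₀ = fun _ j => w j • L⁻¹` has
`‖B(φ₀)ψ‖² ≤ (Σ_j ‖w j‖²) · (‖P_hψ‖² + ‖P_vψ‖²)/(2L²)` (`λ_max ≤ tr` on the PSD zero-momentum
`2 × 2` block; Cauchy–Schwarz). Yang, Rev. Mod. Phys. 34 (1962) 694, §4. [folklore] -/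
theorem zeroMomentumMode_norm_sq_le_mul (w : Fin 2 → ℂ) (ψ : Fock (Orb (FermionTorus 2 L))) :
    (star ((∑ x : TorusSite 2 L, ∑ j : Fin 2, (w j * (L : ℂ)⁻¹) • singletBond L x (Pi.single j 1)) *ᵥ ψ) ⬝ᵥ
      ((∑ x : TorusSite 2 L, ∑ j : Fin 2, (w j * (L : ℂ)⁻¹) • singletBond L x (Pi.single j 1)) *ᵥ ψ)).re ≤
      (∑ j : Fin 2, ‖w j‖ ^ 2) *
        (((expect (Matrix.conjTranspose (pairField (fun e => (extendedSWave e + dWaveFormFactor e) / 2) L) *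
              pairField (fun e => (extendedSWave e + dWaveFormFactor e) / 2) L) ψ).re +
          (expect (Matrix.conjTranspose (pairField (fun e => (extendedSWave e - dWaveFormFactor e) / 2) L) *
              pairField (fun e => (extendedSWave e - dWaveFormFactor e) / 2) L) ψ).re) /
          (2 * (L : ℝ) ^ 2)) := by
  -- adapted from `BondMode.zeroMomentumMode_norm_sq_le` (Literature/.../BondPairModes.lean): the
  -- normalisation `Σ‖w j‖² = 1` there is only used in the last step, kept symbolic here.
  set Ph := pairField (fun e => (extendedSWave e + dWaveFormFactor e) / 2) L with hPh
  set Pv := pairField (fun e => (extendedSWave e - dWaveFormFactor e) / 2) L with hPv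
  set c₀ : ℂ := w 0 * (L : ℂ)⁻¹ * ((1 / Real.sqrt 2 : ℝ) : ℂ) with hc₀
  set c₁ : ℂ := w 1 * (L : ℂ)⁻¹ * ((1 / Real.sqrt 2 : ℝ) : ℂ) with hc₁
  have hop := BondMode.bondModeOp_zeroMomentumMode L w
  rw [hop, PosSemidefTrace.expect_conjTranspose_mul, PosSemidefTrace.expect_conjTranspose_mul,
    BondMode.re_star_dotProduct_self_eq_norm_sq, BondMode.re_star_dotProduct_self_eq_norm_sq,
    BondMode.re_star_dotProduct_self_eq_norm_sq, Matrix.add_mulVec, Matrix.smul_mulVec,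
    Matrix.smul_mulVec, WithLp.toLp_add, WithLp.toLp_smul, WithLp.toLp_smul]
  set vh : EuclideanSpace ℂ (Finset (Orb (FermionTorus 2 L))) := WithLp.toLp 2 (Ph *ᵥ ψ) with hvh
  set vv : EuclideanSpace ℂ (Finset (Orb (FermionTorus 2 L))) := WithLp.toLp 2 (Pv *ᵥ ψ) with hvv
  have hcoef : ‖c₀‖ ^ 2 + ‖c₁‖ ^ 2 = (∑ j : Fin 2, ‖w j‖ ^ 2) * (1 / (2 * (L : ℝ) ^ 2)) := by
    have h2 : ‖((L : ℂ)⁻¹ * ((1 / Real.sqrt 2 : ℝ) : ℂ))‖ ^ 2 = 1 / (2 * (L : ℝ) ^ 2) :=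
      BondMode.norm_inv_mul_inv_sqrt_two_sq L
    have e0 : c₀ = w 0 * ((L : ℂ)⁻¹ * ((1 / Real.sqrt 2 : ℝ) : ℂ)) := by rw [hc₀, mul_assoc]
    have e1 : c₁ = w 1 * ((L : ℂ)⁻¹ * ((1 / Real.sqrt 2 : ℝ) : ℂ)) := by rw [hc₁, mul_assoc]
    rw [e0, e1, norm_mul (w 0), norm_mul (w 1), mul_pow, mul_pow, h2, ← add_mul, Fin.sum_univ_two]
  have htri : ‖c₀ • vh + c₁ • vv‖ ≤ ‖c₀‖ * ‖vh‖ + ‖c₁‖ * ‖vv‖ := by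
    calc ‖c₀ • vh + c₁ • vv‖ ≤ ‖c₀ • vh‖ + ‖c₁ • vv‖ := norm_add_le _ _
      _ = ‖c₀‖ * ‖vh‖ + ‖c₁‖ * ‖vv‖ := by rw [norm_smul, norm_smul]
  have hcs : (‖c₀‖ * ‖vh‖ + ‖c₁‖ * ‖vv‖) ^ 2 ≤ (‖c₀‖ ^ 2 + ‖c₁‖ ^ 2) * (‖vh‖ ^ 2 + ‖vv‖ ^ 2) :=
    BondMode.sq_add_mul_le _ _ _ _
  have hsq : ‖c₀ • vh + c₁ • vv‖ ^ 2 ≤ (‖c₀‖ * ‖vh‖ + ‖c₁‖ * ‖vv‖) ^ 2 :=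
    pow_le_pow_left₀ (norm_nonneg _) htri 2
  calc ‖c₀ • vh + c₁ • vv‖ ^ 2 ≤ (‖c₀‖ ^ 2 + ‖c₁‖ ^ 2) * (‖vh‖ ^ 2 + ‖vv‖ ^ 2) := hsq.trans hcs
    _ = (∑ j : Fin 2, ‖w j‖ ^ 2) * ((‖vh‖ ^ 2 + ‖vv‖ ^ 2) / (2 * (L : ℝ) ^ 2)) := by
        rw [hcoef]; ring

end ZeroMomentum

/-! ### The operator-norm splitting along `V₀ ⊕ V₀^⊥` -/

section Splitting

variable (L : ℕ) [NeZero L]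

/-- **Splitting.** Let `ψ` be a Fock vector and `D ≥ 0` a bound for the bond-pair Gram matrix on the
orthogonal complement of the two uniform modes: every mode `χ` with `Σ_x χ x i = 0` (`i = 0, 1`) has
`‖B(χ)ψ‖² ≤ D · Σ‖χ x i‖²`. Then EVERY mode `φ` has
`‖B(φ)ψ‖² ≤ ((‖P_hψ‖² + ‖P_vψ‖²)/(2L²) + D) · Σ‖φ x i‖²`.
Proof: `φ = φ₀ + φ⊥` with `φ₀ = fun _ j => w j L⁻¹`, `w j = L⁻¹ Σ_x φ x j` (zero-momentum projection),
`Σ‖φ‖² = Σ_j‖w j‖² + Σ‖φ⊥‖²` (Pythagoras), `‖B(φ)ψ‖ ≤ ‖B(φ₀)ψ‖ + ‖B(φ⊥)ψ‖` and Cauchy–Schwarz; i.e.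
`λ_max(M) ≤ λ_max(M|V₀) + λ_max(M|V₀^⊥)` with `λ_max(M|V₀) ≤ tr(M|V₀)`. No translation covariance of `ψ`
is needed. Yang, Rev. Mod. Phys. 34 (1962) 694, §4 (eigenvalues of blocks of `ρ₂`). [folklore] -/
theorem bondMode_norm_sq_le_split (ψ : Fock (Orb (FermionTorus 2 L))) {D : ℝ} (hD : 0 ≤ D)
    (hperp : ∀ χ : TorusSite 2 L → Fin 2 → ℂ, (∀ i, ∑ x, χ x i = 0) →
      (star ((∑ x : TorusSite 2 L, ∑ i : Fin 2, χ x i • singletBond L x (Pi.single i 1)) *ᵥ ψ) ⬝ᵥ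
          ((∑ x : TorusSite 2 L, ∑ i : Fin 2, χ x i • singletBond L x (Pi.single i 1)) *ᵥ ψ)).re ≤
        D * ∑ x, ∑ i, ‖χ x i‖ ^ 2)
    (φ : TorusSite 2 L → Fin 2 → ℂ) :
    (star ((∑ x : TorusSite 2 L, ∑ i : Fin 2, φ x i • singletBond L x (Pi.single i 1)) *ᵥ ψ) ⬝ᵥ
        ((∑ x : TorusSite 2 L, ∑ i : Fin 2, φ x i • singletBond L x (Pi.single i 1)) *ᵥ ψ)).re ≤
      (((expect (Matrix.conjTranspose (pairField (fun e => (extendedSWave e + dWaveFormFactor e) / 2) L) *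
              pairField (fun e => (extendedSWave e + dWaveFormFactor e) / 2) L) ψ).re +
          (expect (Matrix.conjTranspose (pairField (fun e => (extendedSWave e - dWaveFormFactor e) / 2) L) *
              pairField (fun e => (extendedSWave e - dWaveFormFactor e) / 2) L) ψ).re) /
          (2 * (L : ℝ) ^ 2) + D) *
        ∑ x, ∑ i, ‖φ x i‖ ^ 2 := by
  set A : ℝ := ((expect (Matrix.conjTranspose (pairField (fun e => (extendedSWave e + dWaveFormFactor e) / 2) L) *
              pairField (fun e => (extendedSWave e + dWaveFormFactor e) / 2) L) ψ).re +
          (expect (Matrix.conjTranspose (pairField (fun e => (extendedSWave e - dWaveFormFactor e) / 2) L) *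
              pairField (fun e => (extendedSWave e - dWaveFormFactor e) / 2) L) ψ).re) /
          (2 * (L : ℝ) ^ 2) with hA
  have hL : (L : ℂ) ≠ 0 := Nat.cast_ne_zero.2 (NeZero.ne L)
  -- the zero-momentum coefficients and the orthogonal remainder
  obtain ⟨w, hw⟩ : ∃ w : Fin 2 → ℂ, w = fun j => (L : ℂ)⁻¹ * ∑ x, φ x j := ⟨_, rfl⟩
  obtain ⟨φ₁, hφ₁⟩ : ∃ φ₁ : TorusSite 2 L → Fin 2 → ℂ, φ₁ = fun x j => φ x j - w j * (L : ℂ)⁻¹ :=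
    ⟨_, rfl⟩
  have hsplit : ∀ x j, φ x j = w j * (L : ℂ)⁻¹ + φ₁ x j := by
    intro x j; rw [hφ₁]; ring
  have hperp₁ : ∀ j, ∑ x, φ₁ x j = 0 := by
    intro j
    rw [hφ₁]
    simp only [Finset.sum_sub_distrib, Finset.sum_const, Finset.card_univ, BondMode.card_torusSite_two,
      nsmul_eq_mul, Nat.cast_pow]
    rw [hw]
    field_simp
    ring
  -- Pythagoras in mode space
  have hcross : ∑ x : TorusSite 2 L, ∑ j : Fin 2, (w j * (L : ℂ)⁻¹) * conj (φ₁ x j) = 0 := by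
    rw [Finset.sum_comm]
    refine Finset.sum_eq_zero fun j _ => ?_
    rw [← Finset.mul_sum, ← map_sum, hperp₁ j, map_zero, mul_zero]
  have hpyth : ∑ x, ∑ i, ‖φ x i‖ ^ 2 = (∑ j : Fin 2, ‖w j‖ ^ 2) + ∑ x, ∑ i, ‖φ₁ x i‖ ^ 2 := by
    calc ∑ x, ∑ i, ‖φ x i‖ ^ 2
        = ∑ x : TorusSite 2 L, ∑ i : Fin 2, (‖w i * (L : ℂ)⁻¹‖ ^ 2 + ‖φ₁ x i‖ ^ 2 +
            2 * ((w i * (L : ℂ)⁻¹) * conj (φ₁ x i)).re) := by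
          refine Finset.sum_congr rfl fun x _ => Finset.sum_congr rfl fun i _ => ?_
          rw [hsplit x i, Complex.sq_norm, Complex.sq_norm, Complex.sq_norm, Complex.normSq_add]
      _ = (∑ _x : TorusSite 2 L, ∑ i : Fin 2, ‖w i * (L : ℂ)⁻¹‖ ^ 2) + ∑ x, ∑ i, ‖φ₁ x i‖ ^ 2 +
            2 * (∑ x : TorusSite 2 L, ∑ i : Fin 2, (w i * (L : ℂ)⁻¹) * conj (φ₁ x i)).re := by
          simp only [Finset.sum_add_distrib, Complex.re_sum, Finset.mul_sum]
      _ = (∑ j : Fin 2, ‖w j‖ ^ 2) + ∑ x, ∑ i, ‖φ₁ x i‖ ^ 2 := by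
          rw [hcross, BondMode.zeroMomentumMode_norm_sq L w, Complex.zero_re, mul_zero, add_zero]
  -- the operator splits accordingly
  have hop : (∑ x : TorusSite 2 L, ∑ i : Fin 2, φ x i • singletBond L x (Pi.single i 1)) =
      (∑ x : TorusSite 2 L, ∑ i : Fin 2, (w i * (L : ℂ)⁻¹) • singletBond L x (Pi.single i 1)) +
        ∑ x : TorusSite 2 L, ∑ i : Fin 2, φ₁ x i • singletBond L x (Pi.single i 1) := by
    rw [← bondModeOp_add]
    exact Finset.sum_congr rfl fun x _ => Finset.sum_congr rfl fun i _ => by rw [← hsplit x i]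
  -- the two partial bounds
  have h₀ := zeroMomentumMode_norm_sq_le_mul L w ψ
  have h₁ := hperp φ₁ hperp₁
  rw [BondMode.re_star_dotProduct_self_eq_norm_sq] at h₀ h₁ ⊢
  rw [hop, Matrix.add_mulVec, WithLp.toLp_add]
  set v₀ : EuclideanSpace ℂ (Finset (Orb (FermionTorus 2 L))) := WithLp.toLp 2
    ((∑ x : TorusSite 2 L, ∑ i : Fin 2, (w i * (L : ℂ)⁻¹) • singletBond L x (Pi.single i 1)) *ᵥ ψ) with hv₀
  set v₁ : EuclideanSpace ℂ (Finset (Orb (FermionTorus 2 L))) := WithLp.toLp 2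
    ((∑ x : TorusSite 2 L, ∑ i : Fin 2, φ₁ x i • singletBond L x (Pi.single i 1)) *ᵥ ψ) with hv₁
  have hA0 : 0 ≤ A := by
    rw [hA]
    refine div_nonneg (add_nonneg ?_ ?_) (by positivity)
    · rw [PosSemidefTrace.expect_conjTranspose_mul, BondMode.re_star_dotProduct_self_eq_norm_sq]
      positivity
    · rw [PosSemidefTrace.expect_conjTranspose_mul, BondMode.re_star_dotProduct_self_eq_norm_sq]
      positivity
  have hW0 : 0 ≤ ∑ j : Fin 2, ‖w j‖ ^ 2 := Finset.sum_nonneg fun _ _ => sq_nonneg _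
  have hF0 : 0 ≤ ∑ x : TorusSite 2 L, ∑ i : Fin 2, ‖φ₁ x i‖ ^ 2 :=
    Finset.sum_nonneg fun _ _ => Finset.sum_nonneg fun _ _ => sq_nonneg _
  have h₀' : ‖v₀‖ ^ 2 ≤ A * ∑ j : Fin 2, ‖w j‖ ^ 2 := by rw [mul_comm]; exact h₀
  calc ‖v₀ + v₁‖ ^ 2 ≤ (‖v₀‖ + ‖v₁‖) ^ 2 := pow_le_pow_left₀ (norm_nonneg _) (norm_add_le _ _) 2
    _ ≤ (A + D) * ((∑ j : Fin 2, ‖w j‖ ^ 2) + ∑ x, ∑ i, ‖φ₁ x i‖ ^ 2) :=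
        sq_add_le_mul_add (norm_nonneg _) (norm_nonneg _) hA0 hD hW0 hF0 h₀' h₁
    _ = (A + D) * ∑ x, ∑ i, ‖φ x i‖ ^ 2 := by rw [hpyth]

/-- **Homogenisation.** A bound `‖B(φ)ψ‖² ≤ E` for all NORMALISED modes orthogonal to the uniform ones
gives `‖B(χ)ψ‖² ≤ E · Σ‖χ‖²` for ALL modes orthogonal to the uniform ones (scale `χ = ‖χ‖ • χ̂`).
[folklore] -/
theorem bondMode_perp_bound_homog (ψ : Fock (Orb (FermionTorus 2 L))) {E : ℝ}
    (h : ∀ φ : TorusSite 2 L → Fin 2 → ℂ, (∑ x, ∑ i, ‖φ x i‖ ^ 2 = 1) → (∀ i, ∑ x, φ x i = 0) →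
      (star ((∑ x : TorusSite 2 L, ∑ i : Fin 2, φ x i • singletBond L x (Pi.single i 1)) *ᵥ ψ) ⬝ᵥ
          ((∑ x : TorusSite 2 L, ∑ i : Fin 2, φ x i • singletBond L x (Pi.single i 1)) *ᵥ ψ)).re ≤ E)
    (χ : TorusSite 2 L → Fin 2 → ℂ) (hχ : ∀ i, ∑ x, χ x i = 0) :
    (star ((∑ x : TorusSite 2 L, ∑ i : Fin 2, χ x i • singletBond L x (Pi.single i 1)) *ᵥ ψ) ⬝ᵥ
        ((∑ x : TorusSite 2 L, ∑ i : Fin 2, χ x i • singletBond L x (Pi.single i 1)) *ᵥ ψ)).re ≤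
      E * ∑ x, ∑ i, ‖χ x i‖ ^ 2 := by
  set S : ℝ := ∑ x, ∑ i, ‖χ x i‖ ^ 2 with hS
  have hS0 : 0 ≤ S := Finset.sum_nonneg fun _ _ => Finset.sum_nonneg fun _ _ => sq_nonneg _
  rcases hS0.eq_or_lt with hS0' | hSpos
  · -- `χ = 0`
    have hz : ∀ x i, χ x i = 0 := mode_eq_zero_of_norm_sq_eq_zero L χ hS0'.symm
    have hop : (∑ x : TorusSite 2 L, ∑ i : Fin 2, χ x i • singletBond L x (Pi.single i 1)) = 0 :=
      Finset.sum_eq_zero fun x _ => Finset.sum_eq_zero fun i _ => by rw [hz x i, zero_smul]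
    rw [hop, Matrix.zero_mulVec, ← hS0']
    simp
  · -- normalise
    set s : ℝ := Real.sqrt S with hs
    have hs0 : 0 < s := Real.sqrt_pos.2 hSpos
    have hs2 : s ^ 2 = S := Real.sq_sqrt hS0
    set φ : TorusSite 2 L → Fin 2 → ℂ := fun x i => ((s⁻¹ : ℝ) : ℂ) * χ x i with hφ
    have hφn : ∑ x, ∑ i, ‖φ x i‖ ^ 2 = 1 := by
      simp only [hφ]
      rw [mode_norm_sq_smul, Complex.norm_real, Real.norm_eq_abs, abs_inv, abs_of_pos hs0, inv_pow, hs2,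
        ← hS, inv_mul_cancel₀ hSpos.ne']
    have hφ0 : ∀ i, ∑ x, φ x i = 0 := by
      intro i
      simp only [hφ]
      rw [← Finset.mul_sum, hχ i, mul_zero]
    have hb := h φ hφn hφ0
    have hχφ : ∀ x i, χ x i = (s : ℂ) * φ x i := by
      intro x i
      simp only [hφ]
      rw [← mul_assoc, ← Complex.ofReal_mul, mul_inv_cancel₀ hs0.ne', Complex.ofReal_one, one_mul]
    have hop : (∑ x : TorusSite 2 L, ∑ i : Fin 2, χ x i • singletBond L x (Pi.single i 1)) =
        ∑ x : TorusSite 2 L, ∑ i : Fin 2, ((s : ℂ) * φ x i) • singletBond L x (Pi.single i 1) :=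
      Finset.sum_congr rfl fun x _ => Finset.sum_congr rfl fun i _ => by rw [hχφ x i]
    rw [hop, bondMode_norm_sq_smul, Complex.norm_real, Real.norm_eq_abs, abs_of_pos hs0, hs2]
    rw [mul_comm]
    exact mul_le_mul_of_nonneg_right hb hS0

/-- **Fixed-side form of the reduction** (pure linear algebra: any side `L ≥ 1`, any Fock vector `ψ`,
any `E ≥ 0`; no Hamiltonian, no ground-state property, no translation covariance). If every
NORMALISED mode orthogonal to the two uniform modes (`Σ_x φ x 0 = Σ_x φ x 1 = 0`) has `‖B(φ)ψ‖² ≤ E`,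
then EVERY normalised mode has `‖B(φ)ψ‖² ≤ (‖P_hψ‖² + ‖P_vψ‖²)/(2L²) + E`. At `E = εL²` and
`ψ = ψ_L` the hypothesis is exactly the residual goal of the registered stub. Yang, Rev. Mod. Phys. 34
(1962) 694, §4. [folklore] -/
theorem bondMode_norm_sq_le_of_perp (ψ : Fock (Orb (FermionTorus 2 L))) {E : ℝ} (hE : 0 ≤ E)
    (h : ∀ φ : TorusSite 2 L → Fin 2 → ℂ, (∑ x, ∑ i, ‖φ x i‖ ^ 2 = 1) → (∀ i, ∑ x, φ x i = 0) →
      (star ((∑ x : TorusSite 2 L, ∑ i : Fin 2, φ x i • singletBond L x (Pi.single i 1)) *ᵥ ψ) ⬝ᵥ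
          ((∑ x : TorusSite 2 L, ∑ i : Fin 2, φ x i • singletBond L x (Pi.single i 1)) *ᵥ ψ)).re ≤ E)
    (φ : TorusSite 2 L → Fin 2 → ℂ) (hφ : ∑ x, ∑ i, ‖φ x i‖ ^ 2 = 1) :
    (star ((∑ x : TorusSite 2 L, ∑ i : Fin 2, φ x i • singletBond L x (Pi.single i 1)) *ᵥ ψ) ⬝ᵥ
        ((∑ x : TorusSite 2 L, ∑ i : Fin 2, φ x i • singletBond L x (Pi.single i 1)) *ᵥ ψ)).re ≤
      ((expect (Matrix.conjTranspose (pairField (fun e => (extendedSWave e + dWaveFormFactor e) / 2) L) *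
              pairField (fun e => (extendedSWave e + dWaveFormFactor e) / 2) L) ψ).re +
          (expect (Matrix.conjTranspose (pairField (fun e => (extendedSWave e - dWaveFormFactor e) / 2) L) *
              pairField (fun e => (extendedSWave e - dWaveFormFactor e) / 2) L) ψ).re) /
          (2 * (L : ℝ) ^ 2) + E := by
  have h' := bondMode_norm_sq_le_split L ψ hE (bondMode_perp_bound_homog L ψ h) φ
  rw [hφ, mul_one] at h'
  exact h'

end Splitting

end Literature.MathematicalPhysics.QuantumLattice.BondMode

end
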